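import Mathlib.Tactic.DeriveFintype
import Literature.MathematicalPhysics.QuantumLattice.GrassmannIntegral
import Literature.MathematicalPhysics.QuantumFieldTheory.YangMillsOS
import HarnessLib

/-!
# `IsQCDFor`: which OS data are "QCD" (`SU(3)` Yang–Mills + `N_f` fundamental Dirac quarks)

Draft Literature file (docs/m5/drafts; D-0015 / D-0017, conjunct `QCD` of `QuantumFields`; kept
as drafted by D-0018(2) apart from the gen-3 audit fix B1 = `QCDScheme.HasAsymptoticScaling`;
gen-6 audit: namespaces aligned to D-0022 and `afBeta` normalised to the tree's `β = 2/g₀²`).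

**Sources (there is NO official problem text for QCD).** Jaffe–Witten (Clay 2000), §1: QCD is "a
non-abelian gauge theory in which the gauge group is `G = SU(3)`. The additional fields describe
… 'quarks,' … transforming in the fundamental representation of `SU(3)` … (1) It must have a 'mass
gap;' namely there must be some constant `Δ > 0` such that every excitation of the vacuum has
energy at least `Δ`"; §5: "existence of other four-dimensional gauge theories (incorporating
additional fields that preserve asymptotic freedom) … the possible mass gap". Osterwalder–Seiler
1978 / Seiler 1982 Ch. 3: lattice quarks are Grassmann variables integrated by the Berezin
integral against `exp(−ψ̄ D_W(U) ψ)`, `D_W` Wilson's Dirac operator; reflection positivity for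
Wilson fermions. Montvay–Münster 1994 §4.1 ((4.14)–(4.17)), §5.1 (lattice QCD action, meson
fields `ψ̄_f Γ ψ_g`), §3.3.3 ((3.263)–(3.265) asymptotic scaling).

**Reading adopted (interface level).** "QCD with `N_f` flavours" is OS data for a finite family of
hermitian scalar gauge-invariant composite fields — the leading singlet scalar the Wilson action
density excites (`glue`) and the hermitian components of the pseudoscalar bilinears
`P_{fg} = ψ̄_f iγ₅ ψ_g` — whose joint Schwinger functions on `⁰𝒮` are the continuum limits of the
**honest lattice QCD expectations** `⟨X⟩ = ∫dU e^{−βS_W} ∫dψ̄dψ X e^{−ψ̄D(U)ψ} / ∫dU e^{−βS_W} ∫dψ̄dψ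
e^{−ψ̄D(U)ψ}` (signed fermion determinant), along a sequential scheme `(a_k, β_k, L_k, m_f(k),
z_s(k), shift_s(k))`, `a_k → 0` (existence along a sequence: human ruling 2026-08-15, Y2), whose
bare coupling obeys two-loop ASYMPTOTIC SCALING (audit g3 B1: pins `a_k` to the lattice spacing of
the asymptotically free theory) and whose bare masses realise PRESCRIBED renormalised quark
masses `m_f > 0` through a mass-independent `QCDRegularisation` (`m_f(k) = m_crit(k) + a_k m_f /
Z_m(k)`; human ruling 2026-08-15, Q2: "for all positive quark masses") whose mass
renormalisation `Z_m(k)` has the universal leading-log growth `(log a_k⁻²)^{γ₀/(2β₀)}`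
(`QCDRegularisation.HasMassScaling`, audit g8 B1: without it a runaway `Z_m` drives every mass
tuple onto one bare trajectory and `∀ m` is idle). **`IsQCDAlong` is the
definitional placeholder** for "is QCD"; its inhabitation is the constructive content. Not encoded: scalar/vector/tensor
bilinears, baryons, confinement, chiral symmetry breaking, universality (Wilson `r = 1` fermions).

Contents: `QCDField Nf`, `QuarkVar/FermiAlg`, `diracMatrix`, `fermiBoltzmann`,
`pseudoscalarBilinear`, `insertion`, `betaCoeff₀/₁`, `gammaCoeff₀`, `massExponent`, `afBeta`, `QCDScheme`
(+ `HasAsymptoticScaling`, `zeroAF`), `QCDRegularisation` (+ `scheme`, `HasMassScaling`, `canonicalAF`), `smearedInsertion`, `qcdGaugeMeasure` (+ normalisation anchor `qcdGaugeMeasure_eq`),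
`qcdLatticeSchwinger`, `IsQCDAlong`/`IsQCDFor`, `isQCDFor_vacuum`; lattice-level full-spectrum gap
(2026-08-15, audit g4 Q2 / g6 Q4): `QCDLatticeObservable` (+ `fermiGaugeAct`, `onTorus`),
`qcdTorusExpect`, `qcdLatticeConnectedCorr`, `QCDScheme.HasLatticeMassGap`.
-/

open scoped SchwartzMap
open MeasureTheory Filter Topology
open Literature.MathematicalPhysics.AQFT Literature.Probability.LatticeModels Literature.MathematicalPhysics.QuantumLattice

noncomputable section

namespace Literature.MathematicalPhysics.QuantumFieldTheory

local notation "𝔾" => Matrix.specialUnitaryGroup (Fin 3) ℂ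

/-- **Species of hermitian scalar composite fields of `N_f`-flavour QCD** carried by the OS data:
`glue` = the renormalised Wilson action density (continuum: the leading singlet scalar it excites —
with Wilson fermions it mixes with `a⁻¹∑_f ψ̄_f ψ_f`, audit g3 N1); `pseudoRe f g = (P_{fg}+P_{gf})/2`,
`pseudoIm f g = (P_{fg}−P_{gf})/(2i)`, `P_{fg} = ψ̄_f iγ₅ ψ_g`. Only the flavour-changing `f ≠ g`
species certify dynamical quarks (`P_{ff}` has a gluonic hairpin shadow). The labels are redundant
under `f ↔ g` (`pseudoRe f g = pseudoRe g f`, `pseudoIm f g = −pseudoIm g f`) and `pseudoIm f f` is the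
zero field — harmless for an `∃ T` statement (audit g8 N4). [cite: MontvayMunster1994, §5.1 (meson fields)] -/
inductive QCDField (Nf : ℕ) : Type
  | glue : QCDField Nf
  | pseudoRe (f g : Fin Nf) : QCDField Nf
  | pseudoIm (f g : Fin Nf) : QCDField Nf
  deriving DecidableEq, Fintype

section Fermions

variable (Nf L : ℕ) [NeZero L]

/-- Quark variable index on the torus of side `L`: flavour × (site × colour × spin). [cite: MontvayMunster1994, §5.1] -/
abbrev QuarkVar : Type := Fin Nf × (TorusSite 4 L × Fin 3 × Fin 4)

/-- A linear enumeration of the quark variables (the tree's Berezin integral needs one). [folklore] -/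
abbrev FermiIdx : Type := Fin (Fintype.card (QuarkVar Nf L))

/-- The Grassmann algebra of all `ψ̄_v, ψ_v` of one torus (`ψ̄` before `ψ`). [cite: Berezin1966, Ch. I §3] -/
abbrev FermiAlg : Type := GrassmannAlgebra ℂ (FermiIdx Nf L ⊕ₗ FermiIdx Nf L)

variable {Nf L}

/-- The fixed enumeration of quark variables. [folklore] -/
def quarkEquiv : QuarkVar Nf L ≃ FermiIdx Nf L := Fintype.equivFin _

/-- `ψ̄_v`. [cite: MontvayMunster1994, §4.1] -/
def qbar (v : QuarkVar Nf L) : FermiAlg Nf L := psiBar ℂ (quarkEquiv v)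

/-- `ψ_v`. [cite: MontvayMunster1994, §4.1] -/
def q (v : QuarkVar Nf L) : FermiAlg Nf L := psi ℂ (quarkEquiv v)

/-- The `N_f`-flavour Wilson–Dirac matrix `D(U) = ⊕_f D_W(U, m_f, r = 1)` in the `SU(3)` background
`U` (tree `wilsonDirac`, fundamental rep), flavour-diagonal. [cite: MontvayMunster1994, §5.1] [cite: Wilson1974] -/
def diracMatrix (U : GaugeConfig 4 L 𝔾) (mq : Fin Nf → ℝ) :
    Matrix (FermiIdx Nf L) (FermiIdx Nf L) ℂ :=
  Matrix.reindex quarkEquiv quarkEquiv <| Matrix.of fun v w =>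
    if v.1 = w.1 then wilsonDirac (fundamentalRep (Fin 3)) U (mq v.1) 1 v.2 w.2 else 0

/-- The fermionic Boltzmann factor `exp(−ψ̄ D(U) ψ)` as a Grassmann element
(`quadratic A = ∑ Aᵢⱼ ψ̄ᵢψⱼ`). [cite: MontvayMunster1994, §4.1 (4.14)–(4.17)] -/
def fermiBoltzmann (U : GaugeConfig 4 L 𝔾) (mq : Fin Nf → ℝ) : FermiAlg Nf L :=
  grassmannExp (quadratic ℂ (-diracMatrix U mq))

/-- The Berezin integral `∫ dψ̄ dψ` over all quark variables of the torus (tree `berezin`). [cite: Berezin1966, Ch. I §3] -/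
def fermiIntegral : FermiAlg Nf L →ₗ[ℂ] ℂ :=
  GrassmannAlgebra.berezin ℂ (FermiIdx Nf L ⊕ₗ FermiIdx Nf L)

/-- The local pseudoscalar bilinear `P_{fg}(x) = ∑_{a,α,β} ψ̄_{f,x,a,α} (iγ₅)_{αβ} ψ_{g,x,a,β}`
(colour-singlet, hence gauge invariant). [cite: MontvayMunster1994, §5.1] -/
def pseudoscalarBilinear (f g : Fin Nf) (x : TorusSite 4 L) : FermiAlg Nf L :=
  ∑ a : Fin 3, ∑ α : Fin 4, ∑ β : Fin 4,
    (Complex.I * gammaFive α β) • (qbar (f, (x, a, α)) * q (g, (x, a, β)))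

/-- The lattice representative of species `s` at the site `x ∈ ℤ⁴` (read on the torus of side `L`)
in the gauge background `U`, as an even Grassmann element: the Wilson action density for `glue`,
the hermitian combinations of `P_{fg}(x)`, `P_{gf}(x)` for mesons. [cite: MontvayMunster1994, §5.1] [cite: Wilson1974] -/
def insertion (U : GaugeConfig 4 L 𝔾) : QCDField Nf → _root_.Literature.Probability.LatticeModels.Site 4 → FermiAlg Nf L
  | .glue, x => algebraMap ℂ _
      ((actionDensity (fundamentalRep (Fin 3)) (configShift (-x) (torusLift L U)) : ℝ) : ℂ)
  | .pseudoRe f g, x => (1 / 2 : ℂ) •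
      (pseudoscalarBilinear f g (Torus.proj L x) + pseudoscalarBilinear g f (Torus.proj L x))
  | .pseudoIm f g, x => (-Complex.I / 2) •
      (pseudoscalarBilinear f g (Torus.proj L x) - pseudoscalarBilinear g f (Torus.proj L x))

end Fermions

/-- One-loop coefficient of the QCD β-function for `SU(3)` with `N_f` fundamental Dirac flavours,
`b₀ = (11 − 2N_f/3)/(16π²)` (`b₀ > 0 ⟺ N_f ≤ 16` is asymptotic freedom). [cite: MontvayMunster1994, §5.1 (5.66)–(5.67)] -/
def betaCoeff₀ (Nf : ℕ) : ℝ := (11 - 2 * (Nf : ℝ) / 3) / (16 * Real.pi ^ 2)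

/-- Two-loop coefficient `b₁ = (102 − 38N_f/3)/(16π²)²` (universal). [cite: MontvayMunster1994, §5.1 (5.66)] -/
def betaCoeff₁ (Nf : ℕ) : ℝ := (102 - 38 * (Nf : ℝ) / 3) / (16 * Real.pi ^ 2) ^ 2

/-- One-loop coefficient of the quark-mass anomalous dimension for `SU(3)` fundamental quarks,
`γ₀ = 3(N² − 1)/(N · 16π²) = 8/(16π²)` (universal, flavour-independent; Montvay–Münster (5.83):
`γ(g) = γ₀ g² + γ₁ g⁴ + …`). [cite: MontvayMunster1994, §5.1 (5.83)] -/
def gammaCoeff₀ : ℝ := 8 / (16 * Real.pi ^ 2)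

/-- The **leading-log exponent of the running quark mass**, `γ₀/(2β₀) = 12/(33 − 2N_f)` (`4/9` for
`N_f = 3`, `12/29` for `N_f = 2`): the renormalisation-group-invariant quark mass is
`M = m (2β₀g²)^{−γ₀/(2β₀)} exp{∫₀^g [γ/β + γ₀/(β₀h)] dh}` (Montvay–Münster (5.84)), so the bare
subtracted Wilson mass realising a fixed `M` at bare coupling `g₀(a) → 0` is
`a(m₀ − m_c) = a M (2β₀g₀²)^{γ₀/(2β₀)} (1 + o(1)) ≍ a M (log a⁻²)^{−γ₀/(2β₀)}` ((5.91): the lowest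
coefficients `β₀, β₁, γ₀` of the lattice RG functions are the universal ones). [cite: MontvayMunster1994, §5.1 (5.84) and (5.91)] -/
def massExponent (Nf : ℕ) : ℝ := gammaCoeff₀ / (2 * betaCoeff₀ Nf)

/-- `γ₀/(2β₀) = 4/9` for three flavours (the familiar `m̄ ∝ αₛ^{4/9}`). [cite: MontvayMunster1994, §5.1 (5.83)–(5.84)] -/
theorem massExponent_three : massExponent 3 = 4 / 9 := by
  have hπ : Real.pi ^ 2 ≠ 0 := by positivity
  simp only [massExponent, gammaCoeff₀, betaCoeff₀]
  field_simp
  push_cast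
  ring

/-- The **two-loop asymptotic-scaling profile of the TREE's inverse bare coupling** at lattice
spacing `a` for the lattice Λ-parameter `Λ`. Normalisation (audit g6 B1): the tree's
`wilsonAction ρ U = ∑ₚ (N − Re tr ρ(Uₚ))` carries NO factor `1/N`, so the parameter `β` of
`wilsonMeasure ρ β` (weight `exp(−β ∑ₚ (N − Re tr Uₚ))`) is Wilson's `β_W = 2N/g₀²` DIVIDED BY `N`,
i.e. `β = 2/g₀²` for every `SU(N)` (Creutz (7.6), (7.11): `S_□ = β_W (1 − (1/N) Re Tr U_□)`,
`β_W = 2N/g₀²`). Two-loop asymptotic freedom (Creutz (13.19); Montvay–Münster (3.264)):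
`g₀⁻² = b₀ log(1/(a²Λ²)) + (b₁/b₀) log log(1/(a²Λ²)) + O(g₀²)`, hence the profile of the tree's
`β(a) = 2/g₀(a)²` is `2 b₀ log(1/(a²Λ²)) + 2 (b₁/b₀) log log(1/(a²Λ²))` (remainder `o(1)` dropped —
the `o(1)` of `HasAsymptoticScaling`). For `SU(3)` this is one third of the familiar `6/g₀²` profile.
[cite: Creutz2022, (7.11) and (13.19)] [cite: MontvayMunster1994, §3.3.3 (3.263)–(3.265)] -/
def afBeta (Nf : ℕ) (Λ a : ℝ) : ℝ :=
  2 * betaCoeff₀ Nf * Real.log (1 / (a ^ 2 * Λ ^ 2)) +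
    2 * (betaCoeff₁ Nf / betaCoeff₀ Nf) * Real.log (Real.log (1 / (a ^ 2 * Λ ^ 2)))

/-- A **(sequential) scaling scheme for lattice QCD** with `N_f` flavours: lattice spacings
`a_k > 0`, `a_k → 0` (human ruling 2026-08-15, Y2: existence along a sequence), inverse bare
couplings `β_k`, torus half-sides `L_k` with `a_k L_k → ∞`, bare Wilson quark masses `m_f(k)`
(lattice units), per-species multiplicative renormalisations `z_s(k)` and additive counterterms
`shift_s(k)` — all witness DATA. In the statement the bare masses are NOT free data: they are
tied to prescribed renormalised masses through a `QCDRegularisation` (below).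
[cite: MontvayMunster1994, §5.1] [cite: JaffeWitten2000, §6] -/
structure QCDScheme (Nf : ℕ) where
  /-- lattice spacings -/
  a : ℕ → ℝ
  a_pos : ∀ k, 0 < a k
  tendsto_a : Tendsto a atTop (𝓝 0)
  /-- inverse bare coupling in the TREE's normalisation (`wilsonMeasure ρ β`, weight
  `exp(−β ∑ₚ (N − Re tr Uₚ))`): `β = β_W/N = 2/g₀²`. -/
  β : ℕ → ℝ
  L : ℕ → ℕ
  tendsto_L : Tendsto (fun k => a k * L k) atTop atTop
  /-- bare Wilson masses `m_f(k)` in lattice units -/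
  mq : Fin Nf → ℕ → ℝ
  z : QCDField Nf → ℕ → ℝ
  shift : QCDField Nf → ℕ → ℝ

namespace QCDScheme

variable {Nf : ℕ}

/-- Torus side `2L_k+1`. [folklore] -/
def side (sch : QCDScheme Nf) (k : ℕ) : ℕ := 2 * sch.L k + 1

/-- The side is never zero. [folklore] -/
instance neZero_side (sch : QCDScheme Nf) (k : ℕ) : NeZero (sch.side k) := ⟨Nat.succ_ne_zero _⟩

/-- **Asymptotic scaling of the scheme** (the asymptotic-freedom side condition; audit g3, B1;
normalisation audit g6, B1): for some lattice Λ-parameter `Λ > 0` the inverse bare coupling fed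
to `wilsonMeasure` (`β = 2/g₀²` in the tree's normalisation, see `afBeta`) follows the universal
two-loop profile along the sequence, `β_k − afBeta N_f Λ a_k → 0` as `k → ∞` — equivalently
`a⁻¹ exp(−1/(2b₀g₀²)) (b₀g₀²)^{−b₁/(2b₀²)} → Λ`, Montvay–Münster's definition (3.265) of `Λ_LAT`.
It forces `g₀ → 0` at exactly the rate at which the correlation length of the asymptotically
free theory is `≍ a⁻¹`, excluding "continuum limits" at fixed or slowly growing `β` along the chiral
critical line `κ_c(β)` of Wilson fermions (pion-only limits). Meaningful for `N_f ≤ 16` (`b₀ > 0`). [cite: MontvayMunster1994, §3.3.3 (3.263)–(3.265) and §5.1 (5.66)–(5.67)] -/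
def HasAsymptoticScaling (sch : QCDScheme Nf) : Prop :=
  ∃ Λ > 0, Tendsto (fun k => sch.β k - afBeta Nf Λ (sch.a k)) atTop (𝓝 0)

variable (Nf) in
/-- The degenerate scheme: `a_k = 1/(k+1)`, `L_k = (k+1)²`, `z ≡ 0`, asymptotically scaling
`β_k = afBeta N_f 1 a_k` (non-vacuity of the type and of `HasAsymptoticScaling`). [folklore] -/
def zeroAF : QCDScheme Nf where
  a := (SpeciesScheme.zero Unit).a
  a_pos := (SpeciesScheme.zero Unit).a_pos
  tendsto_a := (SpeciesScheme.zero Unit).tendsto_a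
  β := fun k => afBeta Nf 1 ((SpeciesScheme.zero Unit).a k)
  L := (SpeciesScheme.zero Unit).L
  tendsto_L := (SpeciesScheme.zero Unit).tendsto_L
  mq := fun _ _ => 0
  z := fun _ _ => 0
  shift := fun _ _ => 0

/-- `QCDScheme.zeroAF` has `z ≡ 0`. [folklore] -/
@[simp] theorem zeroAF_z (s : QCDField Nf) (k : ℕ) : (zeroAF Nf).z s k = 0 := rfl

/-- `QCDScheme.zeroAF` scales asymptotically (with `Λ = 1`). [folklore] -/
theorem zeroAF_hasAsymptoticScaling : (zeroAF Nf).HasAsymptoticScaling :=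
  ⟨1, one_pos, by simp [zeroAF]⟩

end QCDScheme

/-- **A lattice regularisation of `N_f`-flavour QCD in a mass-independent scheme** (human ruling
2026-08-15, Q2: the statement must hold "for ALL positive quark masses"): the mass-INDEPENDENT
data — spacings `a_k → 0`, bare couplings `β_k`, volumes `L_k`, the (flavour-blind) critical bare
Wilson mass `m_crit(k)` at `β_k` and the mass renormalisation factor `Z_m(k) > 0` — shared by all
values of the renormalised quark masses. Prescribed renormalised masses `m_f > 0` are realised by
the bare trajectory `m_f(k) = m_crit(k) + a_k m_f / Z_m(k)` (Montvay–Münster §5.1: with Wilson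
fermions all flavours share the critical hopping parameter; `m_q = Z_m (m₀ − m_c)/a` up to `O(a)`).
`m_crit`, `Z_m` do not depend on the flavour or on the target masses. Witness DATA — but NOT
free: the statement demands `HasMassScaling` (below; audit g8 B1), `Z_m(k) ≍ c (log a_k⁻²)^{γ₀/(2β₀)}`,
the universal leading-log growth of the honest mass renormalisation (Montvay–Münster (5.84),
(5.91)). Without it a runaway `Z_m(k)` (e.g. `e^{e^k}`) makes `a_k m_f / Z_m(k)` negligible against the
honest `a_k m_f / Z_true(k)`, every tuple `m` is driven onto the single flavour-blind trajectory
`m_crit(k)` (which the witness may park at any fixed massive point), and `∀ m` collapses to "one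
flavour-degenerate massive QCD exists". With it the realised renormalisation-group-invariant masses are
`M_f = M₀ + κ m_f` (`κ = Z_true/Z_m → const > 0`; the overall scale `c` of `Z_m` is the choice of mass
unit, immaterial under `∀ m`), an honest `N_f`-parameter family with all mass splittings. The
flavour-blind offset `M₀ ≥ 0` hidden in `m_crit` is NOT pinned by bare data (the additive mass
renormalisation of Wilson fermions is known only up to `O(aΛ)` in lattice units, the same order as
`a_k m_f / Z_m(k)`); it is pinned to the chiral point by the physical clause
`QCDRegularisation.IsChiralAtZero` ("the lattice gap tends to `0` as `m → 0⁺`", which imports the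
gaplessness of massless `N_f ≥ 2` QCD), conjoined in `QCDOf` since the statement re-type of
2026-08-16 (semantic-vacuity audit §4 item 7; before it `∀ m > 0 ≡ ∀ m > M₀`, `qcdOf_iff_threshold`). [cite: MontvayMunster1994, §5.1 (Wilson quark masses, critical hopping parameter; (5.82)–(5.91) RGI quark mass)] [cite: JaffeWitten2000, §5] -/
structure QCDRegularisation (Nf : ℕ) where
  a : ℕ → ℝ
  a_pos : ∀ k, 0 < a k
  tendsto_a : Tendsto a atTop (𝓝 0)
  /-- inverse bare couplings (tree normalisation `β = 2/g₀²`), mass-independent -/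
  β : ℕ → ℝ
  L : ℕ → ℕ
  tendsto_L : Tendsto (fun k => a k * L k) atTop atTop
  /-- the critical bare Wilson mass at `β_k` (flavour-blind) -/
  mcrit : ℕ → ℝ
  /-- the mass renormalisation factor at `β_k` -/
  Zm : ℕ → ℝ
  Zm_pos : ∀ k, 0 < Zm k

namespace QCDRegularisation

variable {Nf : ℕ}

/-- **The scheme realising the renormalised quark masses `m_f`** in the regularisation `reg`, with
species renormalisations `(z, shift)`: bare masses `m_f(k) = m_crit(k) + a_k m_f / Z_m(k)`.
[cite: MontvayMunster1994, §5.1] -/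
def scheme (reg : QCDRegularisation Nf) (m : Fin Nf → ℝ) (z shift : QCDField Nf → ℕ → ℝ) :
    QCDScheme Nf where
  a := reg.a
  a_pos := reg.a_pos
  tendsto_a := reg.tendsto_a
  β := reg.β
  L := reg.L
  tendsto_L := reg.tendsto_L
  mq := fun f k => reg.mcrit k + reg.a k * m f / reg.Zm k
  z := z
  shift := shift

/-- Unfolding the bare-mass trajectory. [folklore] -/
@[simp] theorem scheme_mq (reg : QCDRegularisation Nf) (m : Fin Nf → ℝ)
    (z shift : QCDField Nf → ℕ → ℝ) (f : Fin Nf) (k : ℕ) :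
    (reg.scheme m z shift).mq f k = reg.mcrit k + reg.a k * m f / reg.Zm k := rfl

variable (Nf) in
/-- The degenerate regularisation underlying `QCDScheme.zeroAF` (`m_crit ≡ 0`, `Z_m ≡ 1`). [folklore] -/
def zeroAF : QCDRegularisation Nf where
  a := (QCDScheme.zeroAF Nf).a
  a_pos := (QCDScheme.zeroAF Nf).a_pos
  tendsto_a := (QCDScheme.zeroAF Nf).tendsto_a
  β := (QCDScheme.zeroAF Nf).β
  L := (QCDScheme.zeroAF Nf).L
  tendsto_L := (QCDScheme.zeroAF Nf).tendsto_L
  mcrit := fun _ => 0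
  Zm := fun _ => 1
  Zm_pos := fun _ => one_pos

/-- **Leading-log scaling of the mass renormalisation** (audit g8 B1; the quark-mass twin of
`QCDScheme.HasAsymptoticScaling`): for some `c > 0`, `Z_m(k) / (log a_k⁻²)^{γ₀/(2β₀)} → c` — the
universal growth of the factor converting a renormalisation-group-invariant quark mass into the
bare subtracted Wilson mass at cutoff `a_k⁻¹` (Montvay–Münster (5.84) in the lattice scheme, (5.91):
`a(m₀ − m_c) = a M (2β₀g₀²)^{γ₀/(2β₀)}(1 + o(1))`, `2β₀g₀² ≍ 2 / log a⁻²` by asymptotic scaling). It is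
what makes `∀ m` in `QCDOf` range over an honest `N_f`-parameter family: a `Z_m` growing faster than
this drives all mass tuples onto one bare trajectory (the collapse witness of audit g8 B1); one
growing slower sends every renormalised mass to `∞` (decoupling). The constant `c` is the choice of
mass unit. Imported belief, of the same standing as two-loop asymptotic scaling: the one-loop
anomalous dimension `γ₀` governs the leading logarithm non-perturbatively. [cite: MontvayMunster1994, §5.1 (5.83)–(5.84) and (5.91)] -/
def HasMassScaling (reg : QCDRegularisation Nf) : Prop :=
  ∃ c > 0, Tendsto (fun k => reg.Zm k / Real.log (1 / reg.a k ^ 2) ^ massExponent Nf) atTop (𝓝 c)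

/-- One over the square of the degenerate spacing exceeds `1` from `k = 1` on. [folklore] -/
theorem one_lt_inv_sq_zeroAF_a {k : ℕ} (hk : k ≠ 0) :
    (1 : ℝ) < 1 / (QCDScheme.zeroAF Nf).a k ^ 2 := by
  have h1 : (1 : ℝ) < (k : ℝ) + 1 := by
    have : (1 : ℝ) ≤ (k : ℝ) := by exact_mod_cast Nat.pos_of_ne_zero hk
    linarith
  have h2 : (1 : ℝ) < ((k : ℝ) + 1) ^ 2 := by nlinarith
  simpa [QCDScheme.zeroAF, SpeciesScheme.zero] using h2

variable (Nf) in
/-- The degenerate regularisation with the CANONICAL mass renormalisation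
`Z_m(k) = (log a_k⁻²)^{γ₀/(2β₀)}` (`k ≥ 1`; `a_k = 1/(k+1)`): non-vacuity of `HasMassScaling`. [folklore] -/
def canonicalAF : QCDRegularisation Nf where
  a := (QCDScheme.zeroAF Nf).a
  a_pos := (QCDScheme.zeroAF Nf).a_pos
  tendsto_a := (QCDScheme.zeroAF Nf).tendsto_a
  β := (QCDScheme.zeroAF Nf).β
  L := (QCDScheme.zeroAF Nf).L
  tendsto_L := (QCDScheme.zeroAF Nf).tendsto_L
  mcrit := fun _ => 0
  Zm := fun k => if k = 0 then 1 else Real.log (1 / (QCDScheme.zeroAF Nf).a k ^ 2) ^ massExponent Nf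
  Zm_pos := fun k => by
    split_ifs with hk
    · exact one_pos
    · exact Real.rpow_pos_of_pos (Real.log_pos (one_lt_inv_sq_zeroAF_a hk)) _

/-- `canonicalAF` has leading-log mass scaling (with `c = 1`). [folklore] -/
theorem canonicalAF_hasMassScaling : (canonicalAF Nf).HasMassScaling := by
  refine ⟨1, one_pos, tendsto_const_nhds.congr' ?_⟩
  filter_upwards [eventually_ne_atTop 0] with k hk
  have hx : 0 < Real.log (1 / (QCDScheme.zeroAF Nf).a k ^ 2) ^ massExponent Nf :=
    Real.rpow_pos_of_pos (Real.log_pos (one_lt_inv_sq_zeroAF_a hk)) _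
  change (1 : ℝ) = (if k = 0 then 1 else Real.log (1 / (QCDScheme.zeroAF Nf).a k ^ 2) ^ massExponent Nf) /
    Real.log (1 / (QCDScheme.zeroAF Nf).a k ^ 2) ^ massExponent Nf
  rw [if_neg hk, div_self hx.ne']

end QCDRegularisation

variable {Nf : ℕ}

/-- The smeared renormalised species-`s` field on the real test function `f` at step `k`:
`Φ_k^s(f) = z_s(k) a_k⁴ ∑_{x ∈ box} f(a_k x) (O_s(x) − shift_s(k))` (Grassmann element). [cite: MontvayMunster1994, §5.1] -/
def smearedInsertion (sch : QCDScheme Nf) (k : ℕ) (U : GaugeConfig 4 (sch.side k) 𝔾)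
    (s : QCDField Nf) (f : 𝓢(EuclideanSpace ℝ (Fin 4), ℝ)) : FermiAlg Nf (sch.side k) :=
  ∑ x ∈ box 4 (sch.L k), ((sch.z s k * sch.a k ^ 4 * f (sch.a k • siteToE x) : ℝ) : ℂ) •
    (insertion U s x - algebraMap ℂ _ ((sch.shift s k : ℝ) : ℂ))

/-- The pure-gauge Wilson probability measure of the scheme at step `k` (the fermion
determinant, with its sign, comes from the Berezin integrals in `qcdLatticeSchwinger`). [cite: Wilson1974] -/
def qcdGaugeMeasure (sch : QCDScheme Nf) (k : ℕ) : Measure (GaugeConfig 4 (sch.side k) 𝔾) :=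
  wilsonMeasure (d := 4) (L := sch.side k) (fundamentalRep (Fin 3)) (sch.β k)

/-- **Normalisation anchor** (audit g6 B1): unfolded, the gauge weight behind `qcdGaugeMeasure` is
`Z⁻¹ exp(−β_k ∑ₚ (3 − Re tr Uₚ)) ∏ₑ dUₑ` — the tree's `β` multiplies `N − Re tr Uₚ` with NO `1/N`,
so `β = β_W/3 = 2/g₀²` for `SU(3)` (Creutz (7.6), (7.11)), and `afBeta` is normalised to THIS `β`.
If this `rfl` ever breaks (tree convention change), re-derive `afBeta`. [cite: Creutz2022, (7.6) and (7.11)] -/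
theorem qcdGaugeMeasure_eq (sch : QCDScheme Nf) (k : ℕ) :
    qcdGaugeMeasure sch k =
      (wilsonWeight (d := 4) (L := sch.side k) (fundamentalRep (Fin 3)) (sch.β k) Set.univ)⁻¹ •
        (Measure.pi fun _ : Edge 4 (sch.side k) => haarProbability 𝔾).withDensity (fun U =>
          ENNReal.ofReal (Real.exp (-sch.β k * ∑ p : Plaquette 4 (sch.side k),
            ((3 : ℕ) - (fundamentalRep (Fin 3) (plaquetteHolonomy U p.1 p.2.1.1 p.2.1.2)).trace.re)))) :=
  rfl

/-- **Lattice QCD `n`-point function** of the species string `σ` on real test functions `fᵢ` at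
step `k` (spacing `a_k`): the honest expectation
`⟨∏ᵢ Φ_a^{σᵢ}(fᵢ)⟩ = ∫dμ_W(U) ∫dψ̄dψ (∏ᵢ Φᵢ) e^{−ψ̄D(U)ψ} / ∫dμ_W(U) ∫dψ̄dψ e^{−ψ̄D(U)ψ}`
(the orientation sign of `berezin` is common to numerator and denominator; junk `0` if the
denominator vanishes or an integrand is not integrable). [cite: OsterwalderSeiler1978] [cite: MontvayMunster1994, §4.1 and §5.1] -/
def qcdLatticeSchwinger (sch : QCDScheme Nf) (k : ℕ) (n : ℕ) (σ : Fin n → QCDField Nf)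
    (f : Fin n → 𝓢(EuclideanSpace ℝ (Fin 4), ℝ)) : ℂ :=
  (∫ U, fermiIntegral ((List.ofFn fun i => smearedInsertion sch k U (σ i) (f i)).prod *
      fermiBoltzmann U fun fl => sch.mq fl k) ∂(qcdGaugeMeasure sch k)) /
    ∫ U, fermiIntegral (fermiBoltzmann U fun fl => sch.mq fl k) ∂(qcdGaugeMeasure sch k)

/-- **`IsQCDAlong sch T`: along the sequential scheme `sch = (a_k, β_k, L_k, m_f(k), z_s(k),
shift_s(k))`, `a_k → 0`, `a_k L_k → ∞`, the OS data `T` (species `QCDField N_f`) are `SU(3)`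
Yang–Mills theory minimally coupled to `N_f` flavours of fundamental Dirac quarks.** Jaffe–Witten
§1/§5 (no official problem text) read through Osterwalder–Seiler's lattice framework:
for every `n ≥ 1`, every species string `σ` and every tensor test function `F = f₁ ⊗ ⋯ ⊗ fₙ ∈ ⁰𝒮`
the lattice QCD `n`-point functions converge to `𝔖ₙ^σ(F)` as `k → ∞` (along a SEQUENCE of
spacings — existence, not uniqueness, of the limit: human ruling 2026-08-15, Y2); the bare
coupling scales asymptotically (`sch.HasAsymptoticScaling`: `g₀ → 0` at the two-loop asymptotic-freedom rate,
so that `a` IS the lattice spacing of the asymptotically free theory — audit g3 B1: otherwise a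
pion-only "continuum limit" at fixed cutoff along the chiral critical line of Wilson fermions would
qualify); and the bare Wilson masses stay eventually on the physical branch, `m_f(k) > −1`, so that
the 15 doublers keep masses `≥ 1/a` and each label is ONE Dirac flavour ("fields that preserve
asymptotic freedom" is then `N_f ≤ 16`, Montvay–Münster (5.67)); `m > −1 ⟺ κ < 1/6` is also the range
in which Osterwalder–Seiler/Lüscher positivity of the Wilson-fermion transfer matrix is proved
(Montvay–Münster (4.111)). **Honesty note.** Definitional
placeholder for "is QCD": fixes the species list, Wilson's gauge and fermion (`r = 1`) actions, bare
masses as scheme data; asserts asymptotic freedom only as bare-coupling scaling, no universality;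
its inhabitation (with OS axioms, non-triviality, non-decoupling, gap) is the constructive content.
[cite: JaffeWitten2000, §1 and §5] [cite: OsterwalderSeiler1978] [cite: Seiler1982, Ch. 3] [cite: MontvayMunster1994, §3.3.3 and §5.1] -/
def IsQCDAlong (sch : QCDScheme Nf) (T : OSData (QCDField Nf) 4) : Prop :=
  sch.HasAsymptoticScaling ∧
    (∀ fl : Fin Nf, ∀ᶠ k in atTop, -1 < sch.mq fl k) ∧
    ∀ (n : ℕ), n ≠ 0 → ∀ (σ : Fin n → QCDField Nf)
      (f : Fin n → 𝓢(EuclideanSpace ℝ (Fin 4), ℝ)) (F : 𝓢((Fin n → EuclideanSpace ℝ (Fin 4)), ℂ)),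
      IsTensorOf F (fun i => ofRealTest (f i)) → IsOffDiagonal F →
        Tendsto (fun k : ℕ => qcdLatticeSchwinger sch k n σ f) atTop (𝓝 (T.schwinger n σ F))

/-- **`IsQCDFor N_f T`**: `T` is QCD with `N_f` flavours along SOME scheme (`IsQCDAlong`). The
statement `QCDOf` binds a `QCDRegularisation` and the renormalised masses (shared with the
lattice gap clause `QCDScheme.HasLatticeMassGap`); this scheme-free form is kept for the API.
[cite: JaffeWitten2000, §1 and §5] [cite: OsterwalderSeiler1978] -/
def IsQCDFor (Nf : ℕ) (T : OSData (QCDField Nf) 4) : Prop :=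
  ∃ sch : QCDScheme Nf, IsQCDAlong sch T

/-- **The degenerate scheme inhabits the placeholder**: with `z ≡ 0` (and asymptotically scaling
`β`) every lattice `n`-point function (`n ≥ 1`) vanishes, so the vacuum-only data are "QCD" in the
placeholder sense — whence the non-triviality and non-decoupling clauses. [folklore] -/
theorem isQCDAlong_zeroAF_vacuum (Nf : ℕ) :
    IsQCDAlong (QCDScheme.zeroAF Nf) (OSData.vacuum (QCDField Nf) 4) := by
  refine ⟨QCDScheme.zeroAF_hasAsymptoticScaling,
    fun _ => Eventually.of_forall fun _ => by norm_num [QCDScheme.zeroAF],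
    fun n hn σ f F _ _ => ?_⟩
  have hS : (OSData.vacuum (QCDField Nf) 4).schwinger n σ F = 0 := by
    simp [OSData.vacuum, LabelledSchwingerFamily.trivial_of_ne_zero (QCDField Nf) hn]
  rw [hS]
  refine tendsto_const_nhds.congr' (Eventually.of_forall fun k => ?_)
  obtain ⟨j, rfl⟩ := Nat.exists_eq_succ_of_ne_zero hn
  simp [qcdLatticeSchwinger, smearedInsertion, List.ofFn_succ]

/-- The vacuum-only data are "QCD" in the placeholder sense (scheme-free form). [folklore] -/
theorem isQCDFor_vacuum (Nf : ℕ) : IsQCDFor Nf (OSData.vacuum (QCDField Nf) 4) :=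
  ⟨QCDScheme.zeroAF Nf, isQCDAlong_zeroAF_vacuum Nf⟩

/-! ### The lattice-level full-spectrum gap for QCD (audit g4 Q2 / g6 Q4; expert standard: "mass
gap" = no spectrum of the FULL Hamiltonian in `(0, Δ)`, exactly as for `YangMills`)

`T.HasMassGap Δ` certifies the gap on the OS space `ℋ_T` generated by the finitely many species
`QCDField N_f` (baryon-number-`0`, the channels those composites excite). To make "every excitation
of the vacuum has energy at least `Δ`" (Jaffe–Witten §1 (1)) witness-independent and literally
full-spectrum, the statement also demands — as `HasLatticeMassGap` does for `YangMills`
(Jaffe–Witten §5 "uniform gap for finite-volume approximations"; audit g4 B2, form F5) — that at the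
scheme's OWN couplings `β_k`, `m_f(k)` the connected Euclidean-time correlations of ALL pairs of
gauge-invariant local lattice QCD observables (bounded functions of finitely many links times
polynomials in finitely many quark variables `ψ, ψ̄`, jointly gauge invariant: all Wilson loops,
all mesons `ψ̄Γψ`, all baryons `εψψψ`, …) decay at rate `Δ` in physical units on every torus at
least as large as the scheme's, uniformly in the volume. By Osterwalder–Seiler / Lüscher's
transfer matrix for Wilson fermions these observables generate the full physical lattice Hilbert
space (all flavour and baryon-number sectors), so the lattice Hamiltonians have no spectrum in
`(0, Δ)` on all of it, for all large `k`. [cite: OsterwalderSeiler1978, §§2–4] [cite: Seiler1982, Ch. 3]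
(Lüscher, CMP 54 (1977) 283: the positive transfer matrix for Wilson fermions.)
-/

section LatticeGap

variable (Nf)

/-- Quark variables of `ℤ⁴` inside the box `{−R,…,R}⁴`: flavour × (site × colour × spin). [cite: MontvayMunster1994, §5.1] -/
abbrev BoxQuarkVar (R : ℕ) : Type := Fin Nf × (↥(box 4 R) × Fin 3 × Fin 4)

/-- A linear enumeration of the boxed quark variables. [folklore] -/
abbrev BoxFermiIdx (R : ℕ) : Type := Fin (Fintype.card (BoxQuarkVar Nf R))

/-- The Grassmann algebra of the `ψ̄_v, ψ_v`, `v` a quark variable in the box of radius `R` of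
`ℤ⁴` (`ψ̄` before `ψ`). [cite: Berezin1966, Ch. I §3] -/
abbrev BoxFermiAlg (R : ℕ) : Type := GrassmannAlgebra ℂ (BoxFermiIdx Nf R ⊕ₗ BoxFermiIdx Nf R)

variable {Nf} {R : ℕ}

/-- The fixed enumeration of boxed quark variables. [folklore] -/
def boxQuarkEquiv : BoxQuarkVar Nf R ≃ BoxFermiIdx Nf R := Fintype.equivFin _

/-- The **lattice gauge transformation `g : ℤ⁴ → SU(3)` on quark variables**, as the linear map of
generator coefficients inducing `ψ(x) ↦ g(x) ψ(x)`, `ψ̄(x) ↦ ψ̄(x) g(x)⁻¹` (colour index; flavour,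
site, spin fixed). `ExteriorAlgebra.map` sends the generator `ψ_v = ι(e_v)` to `ι(L e_v)`, so
`ψ_b ↦ ∑_a g_{ba} ψ_a` needs `L e_b = ∑_a g_{ba} e_a`, i.e. on coefficient vectors
`(L c)_{(ψ,(f,x,b,α))} = ∑_a g(x)_{ab} c_{(f,x,a,α)}` and `(L c̄)_{(ψ̄,(f,x,b,α))} = ∑_a (g(x)⁻¹)_{ba}
c̄_{(f,x,a,α)}` (audit g7 B1: the transposed assignment would implement `ψ ↦ gᵀψ` and exclude the
point-split hadron operators `ψ̄(x) U_{x→y} Γ ψ(y)` from `QCDLatticeObservable`).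
[cite: MontvayMunster1994, §5.1 (gauge transformation of quark fields)] -/
def fermiGaugeLin (g : _root_.Literature.Probability.LatticeModels.Site 4 → 𝔾) :
    ((BoxFermiIdx Nf R ⊕ₗ BoxFermiIdx Nf R) → ℂ) →ₗ[ℂ] ((BoxFermiIdx Nf R ⊕ₗ BoxFermiIdx Nf R) → ℂ) :=
  LinearMap.pi fun w =>
    match ofLex w with
    | Sum.inl i =>
        let v := boxQuarkEquiv.symm i
        ∑ a : Fin 3, ((((g (v.2.1 : _root_.Literature.Probability.LatticeModels.Site 4))⁻¹ : 𝔾) :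
            Matrix (Fin 3) (Fin 3) ℂ) v.2.2.1 a) •
          LinearMap.proj (toLex (Sum.inl (boxQuarkEquiv (v.1, (v.2.1, a, v.2.2.2)))))
    | Sum.inr i =>
        let v := boxQuarkEquiv.symm i
        ∑ a : Fin 3, (((g (v.2.1 : _root_.Literature.Probability.LatticeModels.Site 4) : 𝔾) :
            Matrix (Fin 3) (Fin 3) ℂ) a v.2.2.1) •
          LinearMap.proj (toLex (Sum.inr (boxQuarkEquiv (v.1, (v.2.1, a, v.2.2.2)))))

/-- The gauge transformation `g` acting on the boxed Grassmann algebra (the algebra automorphism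
induced by `fermiGaugeLin g` on generators). [cite: MontvayMunster1994, §5.1] -/
def fermiGaugeAct (g : _root_.Literature.Probability.LatticeModels.Site 4 → 𝔾) :
    BoxFermiAlg Nf R →ₐ[ℂ] BoxFermiAlg Nf R :=
  ExteriorAlgebra.map (fermiGaugeLin g)

variable (Nf R) in
/-- **A gauge-invariant local observable of lattice QCD on `ℤ⁴` with quark content in the box of
radius `R`** (Osterwalder–Seiler 1978 §2: the gauge-invariant elements of the algebra generated by
finitely many link variables and quark Grassmann variables): a function `F` of the gauge field
with values in the Grassmann algebra of the quark variables in `{−R,…,R}⁴`, depending on finitely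
many links (`IsCylinder`), JOINTLY gauge invariant (`U ↦ U^g` on links together with `ψ ↦ gψ`,
`ψ̄ ↦ ψ̄g⁻¹` on the Grassmann generators), with bounded measurable coefficients (tested through
the non-degenerate Berezin pairing `y ↦ ∫dψ̄dψ F(U)·y`). Includes all Wilson loops (any `R`, no
quark), all mesons and baryons, and their products. [cite: OsterwalderSeiler1978, §2] [cite: Seiler1982, Ch. 3] -/
structure QCDLatticeObservable where
  /-- the observable: gauge field ↦ element of the boxed Grassmann algebra -/
  F : LGConfig 4 𝔾 → BoxFermiAlg Nf R
  /-- a finite set of links on which `F` depends -/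
  supp : Finset (ZdEdge 4)
  isCylinder : IsCylinder F supp
  /-- joint gauge invariance in the gauge and quark variables -/
  gaugeInvariant : ∀ (g : _root_.Literature.Probability.LatticeModels.Site 4 → 𝔾) (U : LGConfig 4 𝔾),
    fermiGaugeAct g (F (gaugeTransformZd g U)) = F U
  /-- every Grassmann coefficient of `F` (Berezin pairing with a fixed `y`) is bounded in `U` -/
  bounded : ∀ y : BoxFermiAlg Nf R, ∃ C : ℝ, ∀ U,
    ‖GrassmannAlgebra.berezin ℂ (BoxFermiIdx Nf R ⊕ₗ BoxFermiIdx Nf R) (F U * y)‖ ≤ C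
  /-- every Grassmann coefficient of `F` is measurable in `U` -/
  measurable : ∀ y : BoxFermiAlg Nf R, Measurable fun U =>
    GrassmannAlgebra.berezin ℂ (BoxFermiIdx Nf R ⊕ₗ BoxFermiIdx Nf R) (F U * y)

namespace QCDLatticeObservable

variable (Nf R) in
/-- The unit observable (non-vacuity of the type). [folklore] -/
def one : QCDLatticeObservable Nf R where
  F := fun _ => 1
  supp := ∅
  isCylinder := fun _ _ _ => rfl
  gaugeInvariant := fun g _ => map_one (fermiGaugeAct g)
  bounded := fun _ => ⟨_, fun _ => le_rfl⟩
  measurable := fun _ => measurable_const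

/-- The index map placing the boxed quark variables on the torus of side `S`, translated by
`v ∈ ℤ⁴` (`x ↦ (x + v) mod S`), on both `ψ̄` and `ψ`. [folklore] -/
def toTorusIdx (S : ℕ) [NeZero S] (v : _root_.Literature.Probability.LatticeModels.Site 4) :
    BoxFermiIdx Nf R ⊕ₗ BoxFermiIdx Nf R → FermiIdx Nf S ⊕ₗ FermiIdx Nf S := fun w =>
  match ofLex w with
  | Sum.inl i =>
      let q := boxQuarkEquiv.symm i
      toLex (Sum.inl (quarkEquiv (q.1,
        (Torus.proj S ((q.2.1 : _root_.Literature.Probability.LatticeModels.Site 4) + v), q.2.2))))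
  | Sum.inr i =>
      let q := boxQuarkEquiv.symm i
      toLex (Sum.inr (quarkEquiv (q.1,
        (Torus.proj S ((q.2.1 : _root_.Literature.Probability.LatticeModels.Site 4) + v), q.2.2))))

/-- **The observable `A` placed at `v` on the torus of side `S`**: links read through the
periodic lift translated by `v` (`U ↦ A.F (τ_v Ũ)`, `τ_v Ũ (x, i) = Ũ (x + v, i)`), quark
variables sent to the torus quark variables at `x + v (mod S)` (the algebra map induced on
generators). [cite: OsterwalderSeiler1978, §2] -/
def onTorus (A : QCDLatticeObservable Nf R) (S : ℕ) [NeZero S]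
    (v : _root_.Literature.Probability.LatticeModels.Site 4) (U : GaugeConfig 4 S 𝔾) : FermiAlg Nf S :=
  ExteriorAlgebra.map
      (Fintype.linearCombination ℂ fun w =>
        Pi.single (toTorusIdx (Nf := Nf) (R := R) S v w) (1 : ℂ))
    (A.F (configShift (-v) (torusLift S U)))

end QCDLatticeObservable

/-- **Lattice QCD expectation on the torus of side `S`** at inverse bare coupling `β` (tree
normalisation) and bare masses `m_f` of a Grassmann-valued function `X` of the gauge field:
`⟨X⟩ = ∫dμ_W(U) ∫dψ̄dψ X(U) e^{−ψ̄D(U)ψ} / ∫dμ_W(U) ∫dψ̄dψ e^{−ψ̄D(U)ψ}` (signed determinant; the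
orientation sign of `berezin` cancels; junk `0` if the denominator vanishes). With the tree's
time-periodic `wilsonDirac` this is the `(−1)^F`-twisted trace, equal to the vacuum expectation only
in the limit `S → ∞` (audit g8 N2; Montvay–Münster §4.1 after (4.34): antiperiodicity ⇔ trace). [cite: OsterwalderSeiler1978, §2] [cite: MontvayMunster1994, §4.1 and §5.1] -/
def qcdTorusExpect (β : ℝ) (S : ℕ) [NeZero S] (mq : Fin Nf → ℝ)
    (X : GaugeConfig 4 S 𝔾 → FermiAlg Nf S) : ℂ :=
  (∫ U, fermiIntegral (X U * fermiBoltzmann U mq)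
      ∂(wilsonMeasure (d := 4) (L := S) (fundamentalRep (Fin 3)) β)) /
    ∫ U, fermiIntegral (fermiBoltzmann U mq) ∂(wilsonMeasure (d := 4) (L := S) (fundamentalRep (Fin 3)) β)

/-- **Connected Euclidean-time correlation of lattice QCD on the torus of side `S`**:
`⟨A(0) · B(n e₀)⟩ − ⟨A(0)⟩⟨B(n e₀)⟩` for gauge-invariant local observables `A, B` (`B` translated
by `n` lattice units in Euclidean time = coordinate `0`). [cite: OsterwalderSeiler1978, §§2–4] -/
def qcdLatticeConnectedCorr {R R' : ℕ} (β : ℝ) (S : ℕ) [NeZero S] (mq : Fin Nf → ℝ)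
    (A : QCDLatticeObservable Nf R) (B : QCDLatticeObservable Nf R') (n : ℕ) : ℂ :=
  qcdTorusExpect β S mq (fun U => A.onTorus S 0 U * B.onTorus S (Pi.single 0 (n : ℤ)) U) -
    qcdTorusExpect β S mq (A.onTorus S 0) * qcdTorusExpect β S mq (B.onTorus S (Pi.single 0 (n : ℤ)))

/-- **Uniform lattice mass gap `Δ` of QCD along the scheme, uniformly in the volume** — the QCD
twin of `HasLatticeMassGap` (form F5 of audit g4 B2; Jaffe–Witten §1 (1) "every excitation of the
vacuum has energy at least `Δ`", §5 "uniform gap for finite-volume approximations"): for every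
pair of gauge-invariant local lattice QCD observables `A, B` (any quark boxes `R, R'`) there is
`C` such that for all large `k`, on EVERY torus of side `2S+1 ≥ 2L_k+1`, at the scheme's coupling
`β_k` and bare masses `m_f(k)`, and for all Euclidean-time separations `n ≤ S`,
`‖⟨A · τ_{n e₀}B⟩_{k,S} − ⟨A⟩_{k,S}⟨B⟩_{k,S}‖ ≤ C e^{−Δ a_k n}`. At fixed `k`, `S → ∞` bounds the
correlations for all `n`, so by Lüscher's positive transfer matrix for Wilson fermions
(`m_f > −1`, i.e. `κ < 1/6`, with `r = 1` is the range in which site reflection positivity, hence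
a positive one-step transfer matrix, is PROVED — Montvay–Münster (4.111), sufficient not necessary)
the spectral measure of every vector `ÂΩ_a` lies in `{1} ∪ [0, e^{−aΔ}]`; these vectors span the full
physical Hilbert space (all flavour and baryon-number sectors), so `H_a = −a⁻¹ log T_a` has no
spectrum in `(0, Δ)` on all of it — independently of the species list and renormalisations of the
witness. (Boundary conditions, audit g8 N2: the tree's `wilsonDirac` is time-PERIODIC, so the
finite-torus functional `qcdTorusExpect` is the `(−1)^F`-twisted trace `Tr[(−1)^F T^{2S+1}⋯]/Tr[(−1)^F T^{2S+1}]`,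
not the thermal trace; it converges to the same vacuum expectation as `S → ∞` because
`(2S+1)a_k ≥ (2L_k+1)a_k → ∞` and fermionic states are gapped, which is where the spectral reading
applies; configuration-wise reflection positivity at finite volume is not claimed.) Not false for the honest
witness for any `Δ` below the lightest hadron mass: coefficients are bounded, quark polynomials
have bounded transfer-matrix norm, wrap-around terms on the time-periodic torus are
`O(e^{−m a (S+1−2R)}) ≤ C e^{−Δ a n}` for `n ≤ S`, finite-volume mass shifts are absorbed by
`Δ < m` strict (same bookkeeping as `HasLatticeMassGap`; Lüscher, CMP 54 (1977) 283, for the transfer matrix). [cite: JaffeWitten2000, §1 and §5] [cite: OsterwalderSeiler1978, §§2–4] [cite: Seiler1982, Ch. 3] -/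
def QCDScheme.HasLatticeMassGap (sch : QCDScheme Nf) (Δ : ℝ) : Prop :=
  ∀ (R R' : ℕ) (A : QCDLatticeObservable Nf R) (B : QCDLatticeObservable Nf R'), ∃ C : ℝ,
    ∀ᶠ k in atTop, ∀ S : ℕ, sch.L k ≤ S → ∀ n : ℕ, n ≤ S →
      ‖qcdLatticeConnectedCorr (sch.β k) (2 * S + 1) (fun fl => sch.mq fl k) A B n‖ ≤
        C * Real.exp (-(Δ * (sch.a k * n)))

/-- **Chiral gaplessness at zero renormalised mass** (statement re-type 2026-08-16; semantic-vacuity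
audit §2.5-B / §4 item 7, the clause of audit g7 Q1, human-approved): for every `ε > 0` there is a
tuple of POSITIVE renormalised quark masses `m_f` at which the lattice theory of the regularisation
(bare trajectory `m_f(k) = m_crit(k) + a_k m_f / Z_m(k)`, any species renormalisations — the clause
reads only `β_k`, `m_f(k)`, `L_k`, `a_k`, so `z = shift = 0` is used) does NOT have the uniform
lattice mass gap `ε`: the lattice gap closes as `m → 0⁺`. It PINS the flavour-blind additive offset
hidden in `m_crit` to the chiral point: shifting `m_crit(k) ↦ m_crit(k) + a_k M₀ / Z_m(k)` with
`M₀ > 0` (the symmetry behind `qcdOf_iff_threshold`, `∀ m > 0 ≡ ∀ m > M₀`) would require gapless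
points at renormalised masses `> M₀` of the unshifted regularisation, contradicting the gap clause
of `QCDOf` there. Physical content imported: massless `N_f ≥ 2` QCD is gapless (Goldstone pions,
`m_π² ∝ m_q`); for `N_f ≤ 1` the clause is not expected to hold (no Goldstone boson) — harmless, as
the statement `QCD` only uses `N_f = 2, 3`. [cite: MontvayMunster1994, §5.1 (critical hopping parameter, (5.82)–(5.91))] [cite: JaffeWitten2000, §5] -/
def QCDRegularisation.IsChiralAtZero (reg : QCDRegularisation Nf) : Prop :=
  ∀ ε > (0 : ℝ), ∃ m : Fin Nf → ℝ, (∀ f, 0 < m f) ∧ ¬ (reg.scheme m 0 0).HasLatticeMassGap ε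

end LatticeGap

end Literature.MathematicalPhysics.QuantumFieldTheory

end
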